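import Summits.CriticalPhenomena.CardyFormulaZ2.Theorems.CardyIKTransportIKLinearTransportStubBoxResamplerKernel

/-!
# Stub `stub_BoxResampler` (line `pinned-diagram-exchange`, crux stmt-CriticalPhenomena-5076) —
# THE MARKOV BOX RESAMPLER (law preservation and assembly)

Registered stub `stub_BoxResampler` (`--supports stmt-CriticalPhenomena-5076`): the domain Markov property of the
column-mixed Izergin–Korepin colour field `ν_S` in KERNEL form, as needed by the "resampling of extrema" step of
Manolescu's transport (arXiv:2502.08394 §5.3) re-run on this line. For the box `B = [a, a+w) × [b, b+h)`:
a jointly measurable `G : Obs → Rnd → Obs` transporting `ν_S ⊗ β` to `ν_S`, copying the colours off `B` and the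
diagonal flags off the inner faces of `B`, whose box output reads the input through the LAYER colours only, and
whose `β`-law on events of the box data is comparable within `256^{w+h+1}` uniformly in the input.

Construction (parts G/L/K of the sibling files): `G x u = A x (s (λ x) u)` — `λ x` the black layer cells of `x`,
`s q` a black-box sampler (`exists_sampler`) of the law `(cornerGibbsMeasure tIK VB B 1_q ⊗ coinMeasure ½) ∘ toObs⁻¹`
(Gibbs distribution of the box colours given the layer colouring `q`, corner fugacity `t = √3/2` on the `S`-faces
meeting `B`, fresh fair coins; anti-diagonals forced off `S` by `toObs`), `A x y` = `y` on the box colours and inner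
flags, `x` elsewhere. This file: LAW PRESERVATION (`map_G_eq`) — extensionality by box-local events
(`measure_ext_boxLocal`), finite marginals of `ν_S` = free field (`boxResampler_boxMarginal`, from the landed
`stub_bridgeLaw` + re-anchoring), and the finite Gibbs domain Markov identity (`boxResampler_gibbsMarkov`) —, the
sure clauses, and the assembly with the measurability / comparability lemmas of part K.
-/

noncomputable section

namespace Summit.CriticalPhenomena.CardyFormulaZ2.Theorems.IKLinearTransport.PinnedDiagramExchange

open scoped BigOperators Topology Classical MeasureTheory ProbabilityTheory ENNReal NNReal symmDiff
open Filter Set Function MeasureTheory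
open Literature.Probability.Percolation Literature.Probability.LatticeModels
open Literature.Probability.RandomPlanarGeometry
open Summit.CriticalPhenomena.CardyFormulaZ2.Cruxes.IKMixedBoxCrossing.DefectClosureExploration
  (boxLaw cellRect tIK coe_tIK facesIn antiFaces)
open Summit.CriticalPhenomena.CardyFormulaZ2.Cruxes.IKMixedBoxCrossing.DefectClosureExploration.BridgeOfLawStub
  (toObs measurable_toObs mem_cellRect)
open Summit.CriticalPhenomena.CardyFormulaZ2.Cruxes.IKMixedBoxCrossing.PairedMirrorExploration.PolyDoublingStub
  (determinedOn_mono)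

namespace BoxResampler

section Law

variable {S : Set ℤ} {a b : ℤ} {w h : ℕ}
  {s : Finset (Site 2) → Rnd → Obs} {A : Obs → Obs → Obs} {lam : Obs → Finset (Site 2)} {G : Obs → Rnd → Obs}
  (hsm : ∀ q, Measurable (s q))
  (hsl : ∀ q, β.map (s q) =
    ((cornerGibbsMeasure tIK (facesIn S (cellRect (a - 1) (b - 1) (w + 2) (h + 2))) (cellRect a b w h)
      (fun v => decide (v ∈ q))).prod (coinMeasure half)).map (toObs S))
  (hA : ∀ x y, A x y =
    ({v | if a ≤ v 0 ∧ v 0 < a + w ∧ b ≤ v 1 ∧ v 1 < b + h then v ∈ y.1 else v ∈ x.1},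
     {f | if a ≤ f 0 ∧ f 0 + 1 < a + w ∧ b ≤ f 1 ∧ f 1 + 1 < b + h then f ∈ y.2 else f ∈ x.2}))
  (hlam : ∀ x, lam x = (cellRect (a - 1) (b - 1) (w + 2) (h + 2) \ cellRect a b w h).filter (fun v => v ∈ x.1))
  (hG : ∀ x u, G x u = A x (s (lam x) u))
  {F₀ : Set (Site 2)} (hF₀ : ∀ f : Site 2, f ∈ F₀ ↔ a ≤ f 0 ∧ f 0 + 1 < a + w ∧ b ≤ f 1 ∧ f 1 + 1 < b + h)

include hsm hsl hA hlam hG hF₀ in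
/-- LAW PRESERVATION: the resampler transports `ν_S ⊗ β` to `ν_S`. Both sides agree on every measurable event
determined by a window `[-k, k]²` containing the closure of the box (extensionality by box-local events): the
mass of such an event under the image law is `∫ β{u | G x u ∈ D} dν_S(x)`; the integrand is determined by the
window, so `ν_S` may be replaced by the free field of the window read through `toObs` (`boxResampler_boxMarginal`),
under which the integrand is the Gibbs resampling kernel of part G evaluated at `toObs⁻¹ D` — whose integral is the
free mass of `toObs⁻¹ D` (`boxResampler_gibbsMarkov`), i.e. `ν_S(D)` again. [folklore] -/
theorem map_G_eq : ((νmix S).prod β).map (Function.uncurry G) = νmix S := by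
  haveI : IsProbabilityMeasure β := by
    rw [show β = sitePercolation (Site 2 × ℕ) half from rfl]; infer_instance
  haveI : IsProbabilityMeasure (νmix S) := by
    haveI := CouplingToLimits.isProbabilityMeasure_μIK
    exact Measure.isProbabilityMeasure_map (CouplingToLimits.measurable_obs S).aemeasurable
  have hGm : Measurable (Function.uncurry G) := measurable_G hsm hA hlam hG
  have ht0 : (tIK : ℝ≥0) ≠ 0 := by rw [← NNReal.coe_ne_zero, coe_tIK]; positivity
  refine measure_ext_boxLocal _ _ (a.natAbs + b.natAbs + w + h + 1) fun k hk D hD hdet => ?_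
  -- the window `[-k, k]²` as the cell rectangle `cellRect (-k) (-k) (2k+1) (2k+1)`
  set Λk : Finset (Site 2) := cellRect (-(k : ℤ)) (-(k : ℤ)) (2 * k + 1) (2 * k + 1) with hΛk
  have hwin : ∀ v : Site 2, v ∈ ballInf 0 k ↔ (-(k : ℤ) ≤ v 0 ∧ v 0 < -(k : ℤ) + ((2 * k + 1 : ℕ) : ℤ) ∧
      -(k : ℤ) ≤ v 1 ∧ v 1 < -(k : ℤ) + ((2 * k + 1 : ℕ) : ℤ)) := fun v => by
    simp only [ballInf, mem_setOf_eq, Pi.zero_apply, sub_zero, abs_le]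
    push_cast
    omega
  have hkbd : (|a| + |b| + w + h + 1 : ℤ) ≤ k := by
    rw [← Int.natCast_natAbs, ← Int.natCast_natAbs]; exact_mod_cast hk
  rw [Measure.map_apply hGm hD, Measure.prod_apply (hGm hD)]
  -- the integrand `Ψ x = β{u | G x u ∈ D}` is measurable and determined by the window
  have hΨm : Measurable fun x : Obs => β (Prod.mk x ⁻¹' (Function.uncurry G ⁻¹' D)) :=
    measurable_measure_prodMk_left (hGm hD)
  have hΨ : ∀ x : Obs, β (Prod.mk x ⁻¹' (Function.uncurry G ⁻¹' D)) = β {u | G x u ∈ D} := fun x => rfl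
  have hdetΨ : ∀ x y : Obs, (∀ v : Site 2, -(k : ℤ) ≤ v 0 ∧ v 0 < -(k : ℤ) + ((2 * k + 1 : ℕ) : ℤ) ∧
      -(k : ℤ) ≤ v 1 ∧ v 1 < -(k : ℤ) + ((2 * k + 1 : ℕ) : ℤ) → (v ∈ x.1 ↔ v ∈ y.1) ∧ (v ∈ x.2 ↔ v ∈ y.2)) →
      β (Prod.mk x ⁻¹' (Function.uncurry G ⁻¹' D)) = β (Prod.mk y ⁻¹' (Function.uncurry G ⁻¹' D)) := by
    intro x y hxy
    rw [hΨ, hΨ, beta_apply_G hsm hsl hA hG x hD, beta_apply_G hsm hsl hA hG y hD]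
    have hlxy : lam x = lam y := by
      rw [hlam, hlam]
      refine Finset.filter_congr fun v hv => ?_
      have h1 := (Finset.mem_sdiff.1 hv).1
      rw [mem_cellRect] at h1
      push_cast at h1
      exact (hxy v (by push_cast; omega)).1
    have hAxy : ∀ y' : Obs, (A x y' ∈ D ↔ A y y' ∈ D) := fun y' => hdet _ _ fun v hv => by
      have hv' := hxy v ((hwin v).1 hv)
      simp only [hA, mem_setOf_eq]
      refine ⟨?_, ?_⟩
      · by_cases hp : a ≤ v 0 ∧ v 0 < a + w ∧ b ≤ v 1 ∧ v 1 < b + h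
        · rw [if_pos hp, if_pos hp]
        · rw [if_neg hp, if_neg hp]; exact hv'.1
      · by_cases hq : a ≤ v 0 ∧ v 0 + 1 < a + w ∧ b ≤ v 1 ∧ v 1 + 1 < b + h
        · rw [if_pos hq, if_pos hq]
        · rw [if_neg hq, if_neg hq]; exact hv'.2
    rw [hlxy]
    exact congrArg _ (Set.ext fun z' => hAxy _)
  rw [lintegral_eq_of_determined S (-(k : ℤ)) (-(k : ℤ)) (2 * k + 1) (2 * k + 1) hΨm hdetΨ,
    lintegral_map hΨm (measurable_toObs S)]
  -- under the free field, the integrand is the Gibbs resampling kernel of part G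
  have hΨz : ∀ z : CellConfig, β (Prod.mk (toObs S z) ⁻¹' (Function.uncurry G ⁻¹' D)) =
      ((cornerGibbsMeasure tIK (facesIn S (cellRect (a - 1) (b - 1) (w + 2) (h + 2))) (cellRect a b w h) z.1).prod
        (coinMeasure half)) {z' | ((fun v => if v ∈ cellRect a b w h then z'.1 v else z.1 v),
          (fun v => if v ∈ F₀ then z'.2 v else z.2 v)) ∈ toObs S ⁻¹' D} :=
    fun z => (hΨ _).trans (beta_apply_G_toObs hsm hsl hA hlam hG hF₀ z hD)
  have hKm : Measurable fun z : CellConfig =>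
      ((cornerGibbsMeasure tIK (facesIn S (cellRect (a - 1) (b - 1) (w + 2) (h + 2))) (cellRect a b w h) z.1).prod
        (coinMeasure half)) {z' | ((fun v => if v ∈ cellRect a b w h then z'.1 v else z.1 v),
          (fun v => if v ∈ F₀ then z'.2 v else z.2 v)) ∈ toObs S ⁻¹' D} := by
    rw [show (fun z : CellConfig =>
      ((cornerGibbsMeasure tIK (facesIn S (cellRect (a - 1) (b - 1) (w + 2) (h + 2))) (cellRect a b w h) z.1).prod
        (coinMeasure half)) {z' | ((fun v => if v ∈ cellRect a b w h then z'.1 v else z.1 v),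
          (fun v => if v ∈ F₀ then z'.2 v else z.2 v)) ∈ toObs S ⁻¹' D}) =
      fun z => β (Prod.mk (toObs S z) ⁻¹' (Function.uncurry G ⁻¹' D)) from funext fun z => (hΨz z).symm]
    exact hΨm.comp (measurable_toObs S)
  simp_rw [hΨz]
  -- geometry: the box and its closure lie in the window, faces of the window off the closure avoid the box
  have hBΛ : cellRect a b w h ⊆ Λk := fun v hv => by
    rw [mem_cellRect] at hv ⊢; push_cast; omega
  have hBbarΛ : cellRect (a - 1) (b - 1) (w + 2) (h + 2) ⊆ Λk := fun v hv => by
    rw [mem_cellRect] at hv ⊢; push_cast at hv ⊢; omega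
  have havoid : ∀ f ∈ facesIn S Λk, f ∉ facesIn S (cellRect (a - 1) (b - 1) (w + 2) (h + 2)) →
      ∀ c ∈ cellFace f, c ∉ cellRect a b w h := by
    intro f hf hf' c hc hcB
    have hco := cellFace_coords hc
    rw [mem_cellRect] at hcB
    simp only [facesIn, Finset.mem_filter, mem_innerVertices_cellRect, not_and] at hf hf'
    refine hf' ?_ hf.2
    push_cast
    omega
  have key := boxResampler_gibbsMarkov tIK ht0 half Λk (cellRect a b w h) (facesIn S Λk)
    (facesIn S (cellRect (a - 1) (b - 1) (w + 2) (h + 2))) F₀ (fun _ => false) hBΛ (facesIn_mono S hBbarΛ) havoid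
    (toObs S ⁻¹' D) (measurable_toObs S hD) hKm
  rw [show boxLaw S Λk = ((cornerGibbsMeasure tIK (facesIn S Λk) Λk fun _ => false).prod (coinMeasure half)) from rfl,
    key, ← Measure.map_apply (measurable_toObs S) hD]
  exact (boxResampler_boxMarginal S _ _ _ _ D hD (determinedOn_mono (fun v hv => (hwin v).1 hv) hdet)).symm

end Law

end BoxResampler

open BoxResampler in
/-- **Registered stub `stub_BoxResampler`** (line `pinned-diagram-exchange`): the MARKOV BOX RESAMPLER — the
domain Markov property of `ν_S` in kernel form. For every box `[a, a+w) × [b, b+h)` there is a jointly measurable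
`G : Obs → Rnd → Obs` which (i) transports `ν_S ⊗ β` to `ν_S`; (ii) copies the colours off the box and the diagonal
flags off the inner faces; (iii) produces box colours and inner flags that read the input only through the colours
of the layer of cells around the box; (iv) for events of the box data, has `β`-probabilities comparable within the
factor `Kc^{w+h+1}`, `Kc = 256`, uniformly in the input. Construction: resample the box colours from the
corner-fugacity Gibbs distribution of the box given the layer colours (`t = √3/2` on the `S`-faces meeting the box)
and the inner-face coins afresh, through a black-box sampler driven by the fresh bits. [folklore] -/
theorem stub_BoxResampler :
    ∃ Kc : ℝ, 0 < Kc ∧ ∀ (S : Set ℤ) (a b : ℤ) (w h : ℕ), ∃ G : Obs → Rnd → Obs,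
      Measurable (Function.uncurry G) ∧
      ((νmix S).prod β).map (Function.uncurry G) = νmix S ∧
      (∀ (x : Obs) (u : Rnd) (v : Site 2), ¬ (a ≤ v 0 ∧ v 0 < a + w ∧ b ≤ v 1 ∧ v 1 < b + h) →
        (v ∈ (G x u).1 ↔ v ∈ x.1)) ∧
      (∀ (x : Obs) (u : Rnd) (f : Site 2), ¬ (a ≤ f 0 ∧ f 0 + 1 < a + w ∧ b ≤ f 1 ∧ f 1 + 1 < b + h) →
        (f ∈ (G x u).2 ↔ f ∈ x.2)) ∧
      (∀ (x x' : Obs) (u : Rnd),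
        (∀ v : Site 2, a - 1 ≤ v 0 → v 0 ≤ a + w → b - 1 ≤ v 1 → v 1 ≤ b + h →
          ¬ (a ≤ v 0 ∧ v 0 < a + w ∧ b ≤ v 1 ∧ v 1 < b + h) → (v ∈ x.1 ↔ v ∈ x'.1)) →
        (∀ v : Site 2, a ≤ v 0 ∧ v 0 < a + w ∧ b ≤ v 1 ∧ v 1 < b + h →
          (v ∈ (G x u).1 ↔ v ∈ (G x' u).1)) ∧
        (∀ f : Site 2, a ≤ f 0 ∧ f 0 + 1 < a + w ∧ b ≤ f 1 ∧ f 1 + 1 < b + h →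
          (f ∈ (G x u).2 ↔ f ∈ (G x' u).2))) ∧
      (∀ (x x' : Obs) (E : Set Obs), MeasurableSet E →
        (∀ y y' : Obs, (∀ v : Site 2, a ≤ v 0 ∧ v 0 < a + w ∧ b ≤ v 1 ∧ v 1 < b + h → (v ∈ y.1 ↔ v ∈ y'.1)) →
          (∀ f : Site 2, a ≤ f 0 ∧ f 0 + 1 < a + w ∧ b ≤ f 1 ∧ f 1 + 1 < b + h → (f ∈ y.2 ↔ f ∈ y'.2)) →
          (y ∈ E ↔ y' ∈ E)) →
        β {u | G x u ∈ E} ≤ ENNReal.ofReal (Kc ^ (w + h + 1)) * β {u | G x' u ∈ E}) := by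
  refine ⟨256, by norm_num, fun S a b w h => ?_⟩
  have ht0 : (tIK : ℝ≥0) ≠ 0 := by rw [← NNReal.coe_ne_zero, coe_tIK]; positivity
  -- black-box samplers of the Gibbs-with-coins laws of the box, one per layer colouring
  have hP : ∀ q : Finset (Site 2), IsProbabilityMeasure
      (((cornerGibbsMeasure tIK (facesIn S (cellRect (a - 1) (b - 1) (w + 2) (h + 2))) (cellRect a b w h)
        (fun v => decide (v ∈ q))).prod (coinMeasure half)).map (toObs S)) := fun q => by
    haveI := isProbabilityMeasure_cornerGibbsMeasure_of_ne_zero ht0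
      (facesIn S (cellRect (a - 1) (b - 1) (w + 2) (h + 2))) (cellRect a b w h) (fun v => decide (v ∈ q))
    exact Measure.isProbabilityMeasure_map (measurable_toObs S).aemeasurable
  choose s hs using fun q : Finset (Site 2) => @exists_sampler _ (hP q)
  obtain ⟨A, hA⟩ : ∃ A : Obs → Obs → Obs, ∀ x y, A x y =
      ({v | if a ≤ v 0 ∧ v 0 < a + w ∧ b ≤ v 1 ∧ v 1 < b + h then v ∈ y.1 else v ∈ x.1},
       {f | if a ≤ f 0 ∧ f 0 + 1 < a + w ∧ b ≤ f 1 ∧ f 1 + 1 < b + h then f ∈ y.2 else f ∈ x.2}) :=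
    ⟨_, fun _ _ => rfl⟩
  obtain ⟨lam, hlam⟩ : ∃ lam : Obs → Finset (Site 2), ∀ x,
      lam x = (cellRect (a - 1) (b - 1) (w + 2) (h + 2) \ cellRect a b w h).filter (fun v => v ∈ x.1) :=
    ⟨_, fun _ => rfl⟩
  obtain ⟨G, hG⟩ : ∃ G : Obs → Rnd → Obs, ∀ x u, G x u = A x (s (lam x) u) := ⟨_, fun _ _ => rfl⟩
  have hF₀ : ∀ f : Site 2, f ∈ {f : Site 2 | a ≤ f 0 ∧ f 0 + 1 < a + w ∧ b ≤ f 1 ∧ f 1 + 1 < b + h} ↔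
      a ≤ f 0 ∧ f 0 + 1 < a + w ∧ b ≤ f 1 ∧ f 1 + 1 < b + h := fun f => Iff.rfl
  have hsm : ∀ q, Measurable (s q) := fun q => (hs q).1
  have hsl := fun q => (hs q).2
  refine ⟨G, measurable_G hsm hA hlam hG, map_G_eq hsm hsl hA hlam hG hF₀, ?_, ?_, ?_, ?_⟩
  · intro x u v hv
    rw [hG, hA]
    simp only [mem_setOf_eq, if_neg hv]
  · intro x u f hf
    rw [hG, hA]
    simp only [mem_setOf_eq, if_neg hf]
  · intro x x' u hxx'
    have hl : lam x = lam x' := by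
      rw [hlam, hlam]
      refine Finset.filter_congr fun v hv => ?_
      obtain ⟨h1, h2⟩ := Finset.mem_sdiff.1 hv
      rw [mem_cellRect] at h1 h2
      push_cast at h1
      exact hxx' v (by omega) (by omega) (by omega) (by omega) h2
    refine ⟨fun v hv => ?_, fun f hf => ?_⟩
    · rw [hG, hG, hl, hA, hA]
      simp only [mem_setOf_eq, if_pos hv]
    · rw [hG, hG, hl, hA, hA]
      simp only [mem_setOf_eq, if_pos hf]
  · intro x x' E hE hdet
    exact beta_apply_G_le hsm hsl hA hG x x' hE hdet

end Summit.CriticalPhenomena.CardyFormulaZ2.Theorems.IKLinearTransport.PinnedDiagramExchange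

end
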